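import Summits.ABC.IUTFork.LDHGenuineHullRegimeSlack
import Literature.NumberTheory.Primality.SmoothNumbersLowerBound
import HarnessLib

/-!
# The fork at [IUTchIII] Corollary 3.12, L-DH level, READING (U): the height threshold of
# `LDHGenuineHullRegimeSlack` made ELEMENTARY-EXPLICIT via Chebyshev's lower bound for `π`
# (abc-iut cell, crux ThetaPartII = stmt-ABC-19678, registered stub `stub_hullRegime` / VERDICT RISK ¶7)

Record-only file (D-0012) of the abc-iut cell (WAVE-3 discharge seat abc-iut-c312-d1, gen 5); TAKES NO SIDE on
[IUTchIII] Cor. 3.12 or on the (U)/(P) readings. `LDHGenuineHullRegimeSlack` proves the (U)-volume body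
`Cor22.HullVolumeAtDatum P l (B_III P l)` at every admissible `(P, l)`, `l ≥ 7`, whenever
`log(q^{∤{2,l}}(λ)) ≤ 40·log(d*·l)·(π(d*·l) − C(P,l)/log 2)`, `C(P,l) = 2·d_mod·(log-diff + log 𝔣^{∤{2,l}}) + log(30·l)`,
`d* = 2^12·3^3·5·d_mod`. Here `π(d*·l)` is replaced by the ELEMENTARY Chebyshev lower bound
`π(N) ≥ N·log 2/(2·log(2N))` (`N ≥ 4`; from the tree's integer form `N ≤ 2·size(N)·π(N)`,
`Literature.NumberTheory.Primality.SmoothLB.le_two_mul_size_mul_primeCounting`, i.e. `2^N ≤ (N+1)·lcm(1..N) ≤ (N+1)·N^{π(N)}`),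
so that the threshold becomes the closed form `40·log(d*·l)·(d*·l·log 2/(2·log(2·d*·l)) − C(P,l)/log 2) ≈ 7·10^6·d_mod·l`.

* `primeCounting_ge_mul_log_two_div` — `N·log 2/(2·log(2N)) ≤ π(N)` for `N ≥ 4`;
* `PointDict.hullEstimateOf_BIII_of_logQAvoid_le_explicit` / `hullVolumeAtDatum_BIII_of_logQAvoid_le_explicit` — the
  (U)-volume body at every datum / every `(P, l)` below the closed-form threshold, NO slot-constancy.
[cite: Mochizuki2012, IUTchIV Thm. 1.10 proof Steps (v), (viii) p. 27–30] [claim: Mochizuki2012, status: disputed] for the IUT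
quotations; the prime-counting bound is classical (Chebyshev 1852; Hardy–Wright Thm. 414). HONEST SCOPE: as in the parent file —
arithmetic on the cell's typed constants; OPEN above the threshold; nothing about Cor. 3.12 is asserted.
-/

noncomputable section

namespace Summit.ABC.IUTFork

open Literature.IUT.HodgeTheaters Literature.IUT.LogVolume NumberField IsDedekindDomain
open Literature.NumberTheory.DiophantineGeometry.GenEll
open scoped Nat.Prime

/-! ## Chebyshev's lower bound for `π`, real form -/

/-- `size N ≤ log(2N)/log 2` for `N ≥ 1` (`2^{size N − 1} ≤ N`). [folklore] -/
theorem natSize_le_log_div (N : ℕ) (hN : 1 ≤ N) : (N.size : ℝ) ≤ Real.log (2 * (N : ℝ)) / Real.log 2 := by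
  have hlog2 : (0 : ℝ) < Real.log 2 := Real.log_pos (by norm_num)
  have hs : 0 < N.size := Nat.size_pos.mpr (by omega)
  have h2 : 2 ^ (N.size - 1) ≤ N := Nat.lt_size.mp (by omega)
  have h3 : (2 : ℝ) ^ N.size ≤ 2 * (N : ℝ) := by
    have : 2 ^ N.size ≤ 2 * N := by
      calc 2 ^ N.size = 2 * 2 ^ (N.size - 1) := by rw [← pow_succ']; congr 1; omega
        _ ≤ 2 * N := Nat.mul_le_mul_left 2 h2
    exact_mod_cast this
  rw [le_div_iff₀ hlog2]
  have h4 := Real.log_le_log (by positivity) h3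
  rw [Real.log_pow] at h4
  linarith

/-- **Chebyshev's lower bound for the prime-counting function, real form**: `N·log 2/(2·log(2N)) ≤ π(N)` for `N ≥ 4`
(from the tree's integer form `N ≤ 2·size(N)·π(N)`). [cite: FellowsKoblitz1992, Lemma 1 (proof, smoothness estimate)] -/
theorem primeCounting_ge_mul_log_two_div (N : ℕ) (hN : 4 ≤ N) :
    (N : ℝ) * Real.log 2 / (2 * Real.log (2 * (N : ℝ))) ≤ (π N : ℝ) := by
  have hlog2 : (0 : ℝ) < Real.log 2 := Real.log_pos (by norm_num)
  have hlog2N : 0 < Real.log (2 * (N : ℝ)) := Real.log_pos (by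
    have : (4 : ℝ) ≤ N := by exact_mod_cast hN
    linarith)
  have h1 : (N : ℝ) ≤ 2 * (N.size : ℝ) * (π N : ℝ) := by
    exact_mod_cast Literature.NumberTheory.Primality.SmoothLB.le_two_mul_size_mul_primeCounting hN
  have h2 := natSize_le_log_div N (by omega)
  have hπ : (0 : ℝ) ≤ (π N : ℝ) := Nat.cast_nonneg _
  rw [div_le_iff₀ (by positivity)]
  -- `N·log 2 ≤ 2·size·π·log 2 ≤ 2·(log(2N)/log 2)·π·log 2 = 2·log(2N)·π`
  have h3 : 2 * (N.size : ℝ) * (π N : ℝ) ≤ 2 * (Real.log (2 * (N : ℝ)) / Real.log 2) * (π N : ℝ) :=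
    mul_le_mul_of_nonneg_right (mul_le_mul_of_nonneg_left h2 (by norm_num)) hπ
  have h4 : (N : ℝ) * Real.log 2 ≤ 2 * (Real.log (2 * (N : ℝ)) / Real.log 2) * (π N : ℝ) * Real.log 2 :=
    mul_le_mul_of_nonneg_right (h1.trans h3) hlog2.le
  have h5 : 2 * (Real.log (2 * (N : ℝ)) / Real.log 2) * (π N : ℝ) * Real.log 2 =
      (π N : ℝ) * (2 * Real.log (2 * (N : ℝ))) := by
    field_simp
  linarith [h4, h5.le]

namespace PointDict

variable {P : NFPoint} {l : ℕ}

/-- **READING (U), NO SLOT-CONSTANCY, CLOSED-FORM THRESHOLD: `T.HullEstimateOf (B_III P l)`** for `λ ∈ U_P`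
(minimally presented), `l ≥ 7`, every genuine Θ-volume datum `T` at `(P, l)`, PROVIDED
`log(q^{∤{2,l}}(λ)) ≤ 40·log(d*·l)·(d*·l·log 2/(2·log(2·d*·l)) − (2·d_mod·(log-diff + log 𝔣^{∤{2,l}}) + log(30·l))/log 2)`
(`≈ 7·10^6·d_mod·l`). [cite: Mochizuki2012, IUTchIV Thm. 1.10 proof Steps (v), (viii) p. 27–30] [claim: Mochizuki2012, status: disputed] -/
theorem hullEstimateOf_BIII_of_logQAvoid_le_explicit (T : Cor22.ThetaVolumeDatumAt P l) (hP : P ∈ UP) (h7 : 7 ≤ l)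
    (h : Cor22.logQAvoid P {2, l} ≤
      40 * Real.log (((2 ^ 12 * 3 ^ 3 * 5 * Cor22.dmod P : ℕ) : ℝ) * l)
        * ((((2 ^ 12 * 3 ^ 3 * 5 * Cor22.dmod P * l : ℕ) : ℝ)) * Real.log 2
            / (2 * Real.log (2 * (((2 ^ 12 * 3 ^ 3 * 5 * Cor22.dmod P * l : ℕ) : ℝ))))
          - (2 * (Cor22.dmod P : ℝ) * (P.logDiff + Cor22.logCondAvoid P {2, l}) + Real.log (2 * 3 * 5 * (l : ℝ)))
            / Real.log 2)) :
    T.HullEstimateOf (((l : ℝ) + 1) / 4 * ((1 + 12 * (Cor22.dmod P : ℝ) / l) * (P.logDiff + Cor22.logCondAvoid P {2, l})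
      + 2 * Real.log l + 52 + 20 / 3 * Real.log (((2 ^ 12 * 3 ^ 3 * 5 * Cor22.dmod P : ℕ) : ℝ) * (l : ℝ))
        * (Nat.primeCounting (2 ^ 12 * 3 ^ 3 * 5 * Cor22.dmod P * l) : ℝ))) := by
  have hl1 : 1 ≤ l := by omega
  have hd : 1 ≤ Cor22.dmod P := Cor22.dmod_pos P
  have hN : 4 ≤ 2 ^ 12 * 3 ^ 3 * 5 * Cor22.dmod P * l := by nlinarith
  have hπ := primeCounting_ge_mul_log_two_div _ hN
  have hlmod : 0 ≤ Real.log (((2 ^ 12 * 3 ^ 3 * 5 * Cor22.dmod P : ℕ) : ℝ) * l) := by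
    apply Real.log_nonneg
    have h1 : (1 : ℝ) ≤ ((2 ^ 12 * 3 ^ 3 * 5 * Cor22.dmod P : ℕ) : ℝ) := by
      exact_mod_cast (by nlinarith : 1 ≤ 2 ^ 12 * 3 ^ 3 * 5 * Cor22.dmod P)
    have h2 : (1 : ℝ) ≤ (l : ℝ) := by exact_mod_cast hl1
    nlinarith
  refine hullEstimateOf_BIII_of_logQAvoid_le T hP h7 (h.trans ?_)
  have h40 : (0 : ℝ) ≤ 40 * Real.log (((2 ^ 12 * 3 ^ 3 * 5 * Cor22.dmod P : ℕ) : ℝ) * l) := by positivity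
  exact mul_le_mul_of_nonneg_left (by linarith) h40

/-- **The `∀ T` form with the closed-form threshold: `Cor22.HullVolumeAtDatum P l (B_III P l)` in READING (U), NO
slot-constancy**, at every admissible `(P, l)`, `l ≥ 7`, with
`log(q^{∤{2,l}}(λ)) ≤ 40·log(d*·l)·(d*·l·log 2/(2·log(2·d*·l)) − (2·d_mod·(log-diff + log 𝔣^{∤{2,l}}) + log(30·l))/log 2)` —
VERDICT RISK ¶7 can only bite above `≈ 7·10^6·d_mod·l`. [cite: Mochizuki2012, IUTchIV Thm. 1.10 proof Steps (v), (viii) p. 27–30]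
[claim: Mochizuki2012, status: disputed] -/
theorem hullVolumeAtDatum_BIII_of_logQAvoid_le_explicit (hP : P ∈ UP) (h7 : 7 ≤ l)
    (h : Cor22.logQAvoid P {2, l} ≤
      40 * Real.log (((2 ^ 12 * 3 ^ 3 * 5 * Cor22.dmod P : ℕ) : ℝ) * l)
        * ((((2 ^ 12 * 3 ^ 3 * 5 * Cor22.dmod P * l : ℕ) : ℝ)) * Real.log 2
            / (2 * Real.log (2 * (((2 ^ 12 * 3 ^ 3 * 5 * Cor22.dmod P * l : ℕ) : ℝ))))
          - (2 * (Cor22.dmod P : ℝ) * (P.logDiff + Cor22.logCondAvoid P {2, l}) + Real.log (2 * 3 * 5 * (l : ℝ)))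
            / Real.log 2)) :
    Cor22.HullVolumeAtDatum P l (((l : ℝ) + 1) / 4 * ((1 + 12 * (Cor22.dmod P : ℝ) / l)
      * (P.logDiff + Cor22.logCondAvoid P {2, l}) + 2 * Real.log l + 52
        + 20 / 3 * Real.log (((2 ^ 12 * 3 ^ 3 * 5 * Cor22.dmod P : ℕ) : ℝ) * (l : ℝ))
          * (Nat.primeCounting (2 ^ 12 * 3 ^ 3 * 5 * Cor22.dmod P * l) : ℝ))) :=
  fun T => hullEstimateOf_BIII_of_logQAvoid_le_explicit T hP h7 h

end PointDict

end Summit.ABC.IUTFork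

end
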